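import Literature.ModelTheory.ExponentialFields.SemialgebraicChains
import Literature.AlgebraicTopology.SingularHomology.LocalHomology
import Literature.AlgebraicTopology.SingularHomology.StdSimplexFaces
import Literature.NumberTheory.Transcendental.SemialgebraicMapsProofs
import HarnessLib

/-!
# Semialgebraic singular chains compute singular homology — proof of Huber 2023/24, Prop. 7.4

Sibling proof file of `Literature/ModelTheory/ExponentialFields/SemialgebraicChains.lean`, which
vendors A. Huber, *The period isomorphism in tame geometry* (Math. Nachr. 297 (2024),
doi:10.1002/mana.202200331; arXiv:2204.01402), §7, Proposition 7.4 — "the inclusions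
`S^def_•(X) ⊂ S^sing_•(X)`, `S^{def,C¹}_•(X) ⊂ S^def_•(X)`, … are natural quasi-isomorphisms" — for the
instance `X = U` an open `k`-semialgebraic subset of `ℝ^N`, as the named fact
`Literature.ModelTheory.ExponentialFields.Huber2023_semialgChains_quasiIso` (elementwise form
`ComputesHomologyIn`, `ℤ` coefficients). Here that fact is **proved**:
`Literature.ModelTheory.ExponentialFields.Huber2023_semialgChains_quasiIso_holds`.

## The printed proof and the proof given here

Huber proves Prop. 7.4 by Warner's fine-resolution argument (her Thm. 4.7: the complexes of sheaves
of definable chains are fine resolutions of `ℤ`; the key local step is the cone `σ ↦ c·σ` inside a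
ball, "contained in `X` because `X` is convex", and barycentric subdivision to pass from the presheaf
to the sheaf, Warner 1983, 5.32/5.23), alternatively by the comparison theorem of Edmundo–Woerheide.
Mathlib has no sheaf-theoretic comparison for singular chains, so we run the *same two ingredients
in their elementary, chain-level form* for an open `U ⊆ ℝ^N` (Hatcher 2002, proofs of Prop. 2.21 and
Thm. 2.10):

1. **Smallness by subdivision** (tree: `…SingularHomology.Subdivision`, `…LocalHomology`): for a
   chain `c` in `U` some iterated barycentric subdivision `Sʲ c` has every simplex inside a ball
   `B(x, ρ)` with `B(x, 2ρ) ⊆ U` (`exists_sdX_pow_mem_smallChains`), and `Dⱼ` with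
   `∂Dⱼ + Dⱼ∂ = 1 - Sʲ` (`bd_sdhSum_add_sdhSum_bd`).
2. **Local straightening in balls** (this file): a small simplex `τ` is replaced by the affine
   simplex `str r τ` on its vertices moved to nearby *rational* points by a rounding map `r`; the
   straight-line homotopy from `τ` to `str r τ` stays in the convex ball `B(x, 2ρ) ⊆ U`, and its
   **explicit affine prism operator** `P` (Hatcher's `[v₀, …, vᵢ, wᵢ, …, wₙ]` decomposition of
   `Δⁿ × I`, built here on tuple chains by the recursion `P[v₀…vₙ] = (v₀,0)·(top[v] - P[v₁…vₙ])`)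
   satisfies `∂P + P∂ = str - 1` (`bd_prismOp_succ`, `bd_prismOp_zero`).

Then (i) a cycle `z` in `U` satisfies `z - str(Sʲz) = ∂(Dⱼ z - P(Sʲ z))`, and (ii) an `A`-chain
`a = ∂c` satisfies `a = ∂(Dⱼ a - P(Sʲ a) + str(Sʲ c))` (`computesHomologyIn_of_closure`), where
`A = S^def` or `S^{def,C¹}`; what is needed of `A` is that it contains the rational affine simplices
and is stable under `Sʲ`, `Dⱼ` and `P`. These closure properties are reduced to simplexwise ones
(`closure_of_simplexwise`; the vertices of the simplices of `Sʲ Δⁿ`, `T Sⁱ Δⁿ` are rational points,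
`isRatPt_of_mem_support_sd_iterate`) and proved from the tree's real semialgebraic toolkit
(`…Transcendental.SemialgebraicMapsProofs`: composites, sums and products of semialgebraic maps,
BCR Prop. 2.2.6, all discharged there from the tree's Tarski–Seidenberg theorem): rational affine
simplices are `k`-semialgebraic (`isSemialg_affSimplex_rat`, rationals lie in every subfield `k`),
restrictions along rational affine simplices of `Δⁿ` are (`isSemialg_compose`), and so are the prism
pieces `u ↦ b₀(u) τ(Lu) + b₁(u) ℓ(Lu)` (`isSemialg_cylCompose_lineHtpy`); the `C¹`-on-open-faces
versions are the chain rule plus the fact that the affine maps in question send open faces into open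
faces (`mapsTo_openFace`).

Everything is proved; the only definitions are auxiliary constructions with bodies (tuple prisms,
affine prism simplices, affine simplices, straightening, the prism operator, the ball cover,
rational points, two continuous linear maps); no named fact is introduced.

## Main results

* `Huber2023.bd_prismT_succ`, `bd_prismT_zero` — prism formula on tuple chains;
* `Huber2023.bd_prismOp_succ`, `bd_prismOp_zero` — `∂P + P∂ = str - 1` on singular chains of a
  real topological vector space;
* `Huber2023.computesHomologyIn_of_closure` — the homological skeleton for open `U ⊆ ℝ^N`;
* `Huber2023.closure_of_simplexwise`, `semialgSimplices_closure`, `semialgC1Simplices_closure`;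
* `Huber2023_semialgChains_quasiIso_holds`.

## References

* [Huber2023] A. Huber, *The period isomorphism in tame geometry*, Math. Nachr. 297 (2024),
  §7 Notation 7.1, Proposition 7.4 and its proof via Thm. 4.7 (read, pp. 6 and 10 of the
  materialised text).
* [HatcherAT2002] A. Hatcher, *Algebraic Topology*, CUP 2002, §2.1, Thm. 2.10 (prism operator),
  Prop. 2.21 (small chains).
* [Warner1983] F. Warner, *Foundations of Differentiable Manifolds and Lie Groups*, 5.32 (cone
  construction in a ball), as used in [Huber2023, proof of Thm. 4.7].
* [BochnakCosteRoy1998] J. Bochnak, M. Coste, M.-F. Roy, *Real Algebraic Geometry*, Prop. 2.2.6.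
-/

noncomputable section

open scoped Classical

open Set
open Literature.AlgebraicTopology.SingularHomology

namespace Literature.ModelTheory.ExponentialFields

namespace Huber2023

universe u

/-! ### Tuple prisms -/

section TuplePrism

open TupleChain

variable {V : Type u}

/-- The bottom (`b = 0`) and top (`b = 1`) copies `v ↦ (v, b)` of a vertex type in the vertex type
`V × Fin 2` of prisms over tuples of `V`. [folklore] -/
def liftV (b : Fin 2) : V → V × Fin 2 := fun v => (v, b)

/-- `liftV b v = (v, b)`. [folklore] -/
@[simp] lemma liftV_apply (b : Fin 2) (v : V) : liftV b v = (v, b) := rfl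

/-- The **prism** on tuple chains, `P : Cₙ(V) → Cₙ₊₁(V × Fin 2)`, defined by the recursion
`P[v₀] = [(v₀,0), (v₀,1)]`, `P[v₀, …, vₙ₊₁] = (v₀,0) · ([(v₀,1), …, (vₙ₊₁,1)] - P[v₁, …, vₙ₊₁])`;
unfolding the recursion gives Hatcher's prism `∑ᵢ (-1)ⁱ [v₀, …, vᵢ, wᵢ, …, wₙ]` (Hatcher 2002, proof
of Thm. 2.10), but only the recursion is used. [folklore] -/
def prismT : (n : ℕ) → TupleChain V n →ₗ[ℤ] TupleChain (V × Fin 2) (n + 1)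
  | 0 => Finsupp.lsum ℤ fun v =>
      LinearMap.id.smulRight (cone (v 0, (0 : Fin 2)) (Finsupp.single (liftV 1 ∘ v) 1))
  | n + 1 => Finsupp.lsum ℤ fun v =>
      LinearMap.id.smulRight (cone (v 0, (0 : Fin 2))
        (Finsupp.single (liftV 1 ∘ v) 1 - prismT n (Finsupp.single (v ∘ Fin.succ) 1)))

/-- `P[v₀] = c • (v₀,0)·[(v₀,1)]`. [folklore] -/
lemma prismT_zero_single (v : Fin (0 + 1) → V) (c : ℤ) :
    prismT 0 (Finsupp.single v c) =
      c • cone (v 0, (0 : Fin 2)) (Finsupp.single (liftV 1 ∘ v) 1) := by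
  simp [prismT]

/-- The prism recursion on an elementary chain of positive degree. [folklore] -/
lemma prismT_succ_single {n : ℕ} (v : Fin (n + 2) → V) (c : ℤ) :
    prismT (n + 1) (Finsupp.single v c) =
      c • cone (v 0, (0 : Fin 2))
        (Finsupp.single (liftV 1 ∘ v) 1 - prismT n (Finsupp.single (v ∘ Fin.succ) 1)) := by
  simp [prismT]

/-- Naturality of the tuple prism under maps of vertex types. [folklore] -/
lemma push_prismT {V' : Type u} (g : V → V') :
    ∀ (n : ℕ) (x : TupleChain V n),
      push (Prod.map g id) (n + 1) (prismT n x) = prismT n (push g n x)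
  | 0, x => by
    induction x using Finsupp.induction_linear with
    | zero => simp
    | add x y hx hy => simp only [map_add, hx, hy]
    | single v c =>
      rw [prismT_zero_single, push_single, prismT_zero_single, map_zsmul, push_cone, push_single]
      rfl
  | n + 1, x => by
    induction x using Finsupp.induction_linear with
    | zero => simp
    | add x y hx hy => simp only [map_add, hx, hy]
    | single v c =>
      rw [prismT_succ_single, push_single, prismT_succ_single, map_zsmul, push_cone, map_sub,
        push_single, push_prismT g n, push_single]
      rfl

/-- In degree `0` the constant tuple at the bottom copy of `v₀` is the bottom copy of `[v₀]`. [folklore] -/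
lemma const_eq_liftV_zero_comp (v : Fin (0 + 1) → V) :
    (fun _ : Fin (0 + 1) => (v 0, (0 : Fin 2))) = liftV 0 ∘ v := by
  funext j
  have hj : j = 0 := Subsingleton.elim (α := Fin 1) _ _
  subst hj
  rfl

/-- **Prism boundary formula in degree `0`**: `∂ P x = top x - bot x`. [folklore] -/
theorem bd_prismT_zero (x : TupleChain V 0) :
    bd 0 (prismT 0 x) = push (liftV 1) 0 x - push (liftV 0) 0 x := by
  induction x using Finsupp.induction_linear with
  | zero => simp
  | add x y hx hy => simp only [map_add, hx, hy]; abel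
  | single v c =>
    rw [prismT_zero_single, map_zsmul, bd_cone_single_zero, const_eq_liftV_zero_comp, push_single,
      push_single, smul_sub, Finsupp.smul_single_one, Finsupp.smul_single_one]

/-- The subtracted term of the prism recursion: `W₀ v = 0`, `Wₙ₊₁ v = P[v₁, …, vₙ₊₁]`. [folklore] -/
def prismW : (n : ℕ) → (Fin (n + 1) → V) → TupleChain (V × Fin 2) n
  | 0, _ => 0
  | n + 1, v => prismT n (Finsupp.single (v ∘ Fin.succ) 1)

/-- The correction term of the boundary formula: `R₀ = 0`, `Rₙ₊₁ = Pₙ ∘ ∂`. [folklore] -/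
def prismR : (n : ℕ) → TupleChain V n →ₗ[ℤ] TupleChain (V × Fin 2) n
  | 0 => 0
  | n + 1 => prismT n ∘ₗ bd n

/-- Uniform form of the recursion: `P[v] = c • (v₀,0)·(top[v] - Wₙ v)`. [folklore] -/
lemma prismT_single_eq : ∀ (n : ℕ) (v : Fin (n + 1) → V) (c : ℤ),
    prismT n (Finsupp.single v c) =
      c • cone (v 0, (0 : Fin 2)) (Finsupp.single (liftV 1 ∘ v) 1 - prismW n v)
  | 0, v, c => by rw [prismT_zero_single, prismW, sub_zero]
  | n + 1, v, c => by rw [prismT_succ_single, prismW]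

/-- The key cancellation: `Rₙ [v₁, …, vₙ₊₁] = ∑ᵢ (-1)ⁱ Wₙ (v ∘ δᵢ₊₁)` (the simplicial identity
`δᵢ₊₁ δ₀ = δ₀ δᵢ`). [folklore] -/
lemma prismR_single_comp_succ : ∀ (n : ℕ) (v : Fin (n + 2) → V),
    prismR n (Finsupp.single (v ∘ Fin.succ) 1) =
      ∑ i : Fin (n + 1), (-1 : ℤ) ^ (i : ℕ) • prismW n (v ∘ Fin.succAbove i.succ)
  | 0, v => by simp [prismR, prismW]
  | n + 1, v => by
    rw [prismR, LinearMap.comp_apply, bd_single, map_sum]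
    refine Finset.sum_congr rfl fun i _ => ?_
    rw [map_zsmul, prismW]
    congr 3
    funext m
    simp [Fin.succ_succAbove_succ]

/-- The bottom copy of `[v]` as a cone over the bottom copy of `[v₁, …]`. [folklore] -/
lemma cons_liftV_zero {n : ℕ} (v : Fin (n + 2) → V) :
    (Fin.cons (v 0, (0 : Fin 2)) (liftV 0 ∘ (v ∘ Fin.succ)) : Fin (n + 2) → V × Fin 2) = liftV 0 ∘ v := by
  funext j
  refine Fin.cases ?_ (fun l => ?_) j <;> rfl

/-- **Prism boundary formula**, uniform version: `∂ Pₙ x = top x - bot x - Rₙ x`. [folklore] -/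
theorem bd_prismT_eq : ∀ (n : ℕ) (x : TupleChain V n),
    bd n (prismT n x) = push (liftV 1) n x - push (liftV 0) n x - prismR n x
  | 0, x => by rw [bd_prismT_zero, prismR, LinearMap.zero_apply, sub_zero]
  | n + 1, x => by
    induction x using Finsupp.induction_linear with
    | zero => simp
    | add x y hx hy => simp only [map_add, hx, hy]; abel
    | single v c =>
      have IH := bd_prismT_eq n
      -- reduce to `c = 1`
      suffices key : bd (n + 1) (prismT (n + 1) (Finsupp.single v 1)) =
          push (liftV 1) (n + 1) (Finsupp.single v 1) - push (liftV 0) (n + 1) (Finsupp.single v 1) -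
            prismR (n + 1) (Finsupp.single v 1) by
        rw [← Finsupp.smul_single_one v c, map_zsmul, map_zsmul, map_zsmul, map_zsmul, map_zsmul, key,
          smul_sub, smul_sub]
      have hR : prismR (n + 1) (Finsupp.single v 1) =
          prismT n (Finsupp.single (v ∘ Fin.succ) 1) +
            ∑ i : Fin (n + 1), (-1 : ℤ) ^ ((i.succ : Fin (n + 2)) : ℕ) •
              cone (v 0, (0 : Fin 2)) (Finsupp.single (liftV 1 ∘ (v ∘ Fin.succAbove i.succ)) 1 -
                prismW n (v ∘ Fin.succAbove i.succ)) := by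
        rw [prismR, LinearMap.comp_apply, bd_single, map_sum, Fin.sum_univ_succ]
        simp only [Fin.val_zero, pow_zero, one_smul, Fin.succAbove_zero, map_zsmul]
        congr 1
        refine Finset.sum_congr rfl fun i _ => ?_
        rw [prismT_single_eq, one_smul, Function.comp_apply, Fin.succ_succAbove_zero]
      rw [prismT_single_eq, one_smul, bd_cone_succ, map_sub, prismW, IH, bd_single (liftV 1 ∘ v) 1,
        Fin.sum_univ_succ, prismR_single_comp_succ, hR, push_single, push_single]
      simp only [Fin.val_zero, pow_zero, one_smul, Fin.succAbove_zero, map_add, map_sub, map_sum,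
        map_zsmul, push_single, cone_single, cons_liftV_zero, smul_sub, Finset.sum_sub_distrib]
      simp only [Fin.val_succ, pow_succ, mul_neg, mul_one, neg_smul, Finset.sum_neg_distrib,
        Function.comp_def]
      abel

end TuplePrism

/-- Derived form: `∂ Pₙ₊₁ x = top x - bot x - Pₙ (∂ x)`. [folklore] -/
theorem bd_prismT_succ {V : Type u} (n : ℕ) (x : TupleChain V (n + 1)) :
    TupleChain.bd (n + 1) (prismT (n + 1) x) =
      TupleChain.push (liftV 1) (n + 1) x - TupleChain.push (liftV 0) (n + 1) x -
        prismT n (TupleChain.bd n x) := by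
  rw [bd_prismT_eq]
  rfl

/-! ### Affine prisms `Δᵏ → Δⁿ × Δ¹` and realization of prism tuples -/

section Cylinder

open TupleChain SingularSimplex

variable {X : Type u} [TopologicalSpace X] {n k m : ℕ}

/-- The affine simplex `Δᵏ → Δⁿ × Δ¹` with vertices `(e_{w j}, e_{b j})` prescribed by a tuple
`w : Fin (k+1) → Fin (n+1) × Fin 2` of prism vertices: both components are Mathlib's
`stdSimplex.map` (push-forward of barycentric weights). [folklore] -/
def cylAff (w : Fin (k + 1) → Fin (n + 1) × Fin 2) : C(StdSimplex k, StdSimplex n × StdSimplex 1) where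
  toFun u := (stdSimplex.map (fun j => (w j).1) u, stdSimplex.map (fun j => (w j).2) u)
  continuous_toFun := (stdSimplex.continuous_map _).prodMk (stdSimplex.continuous_map _)

/-- First component of an affine prism simplex. [folklore] -/
@[simp] lemma cylAff_apply_fst (w : Fin (k + 1) → Fin (n + 1) × Fin 2) (u : StdSimplex k) :
    (cylAff w u).1 = stdSimplex.map (fun j => (w j).1) u := rfl

/-- Second component of an affine prism simplex. [folklore] -/
@[simp] lemma cylAff_apply_snd (w : Fin (k + 1) → Fin (n + 1) × Fin 2) (u : StdSimplex k) :
    (cylAff w u).2 = stdSimplex.map (fun j => (w j).2) u := rfl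

/-- Faces of affine prism simplices: `[w] ∘ δᵢ = [w ∘ δᵢ]`. [folklore] -/
lemma cylAff_comp_stdFace (w : Fin (k + 2) → Fin (n + 1) × Fin 2) (i : Fin (k + 2)) :
    (cylAff w).comp (stdFace i) = cylAff (w ∘ Fin.succAbove i) := by
  ext u : 1
  refine Prod.ext ?_ ?_
  · change stdSimplex.map (fun j => (w j).1) (stdSimplex.map (Fin.succAbove i) u) = _
    rw [stdSimplex.map_comp_apply]
    rfl
  · change stdSimplex.map (fun j => (w j).2) (stdSimplex.map (Fin.succAbove i) u) = _
    rw [stdSimplex.map_comp_apply]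
    rfl

/-- The product map `Δᵐ × Δ¹ → Δⁿ × Δ¹` induced by `f : Fin (m+1) → Fin (n+1)` on the first factor. [folklore] -/
def cylMap (f : Fin (m + 1) → Fin (n + 1)) : C(StdSimplex m × StdSimplex 1, StdSimplex n × StdSimplex 1) where
  toFun q := (stdSimplex.map f q.1, q.2)
  continuous_toFun := ((stdSimplex.continuous_map _).comp continuous_fst).prodMk continuous_snd

/-- `cylMap f` as a function. [folklore] -/
@[simp] lemma cylMap_apply (f : Fin (m + 1) → Fin (n + 1)) (q : StdSimplex m × StdSimplex 1) :
    cylMap f q = (stdSimplex.map f q.1, q.2) := rfl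

/-- Naturality of affine prism simplices in the first factor. [folklore] -/
lemma cylAff_prodMap (f : Fin (m + 1) → Fin (n + 1)) (w : Fin (k + 1) → Fin (m + 1) × Fin 2) :
    cylAff (Prod.map f id ∘ w) = (cylMap f).comp (cylAff w) := by
  ext u : 1
  refine Prod.ext ?_ ?_
  · change stdSimplex.map (fun j => f (w j).1) u = stdSimplex.map f (stdSimplex.map (fun j => (w j).1) u)
    rw [stdSimplex.map_comp_apply]
    rfl
  · rfl

/-- `h ∘ [w]`: the singular `k`-simplex of `X` cut out of a map `h : Δⁿ × Δ¹ → X` ("homotopy of a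
simplex") by the affine prism simplex `[w]`. [folklore] -/
def cylCompose (h : C(StdSimplex n × StdSimplex 1, X)) (w : Fin (k + 1) → Fin (n + 1) × Fin 2) :
    SingularSimplex X k :=
  ofMap (h.comp (cylAff w))

/-- Faces of `h ∘ [w]` are `h ∘ [w ∘ δᵢ]`. [folklore] -/
lemma cylCompose_face (h : C(StdSimplex n × StdSimplex 1, X)) (w : Fin (k + 2) → Fin (n + 1) × Fin 2)
    (i : Fin (k + 2)) : (cylCompose h w).face i = cylCompose h (w ∘ Fin.succAbove i) := by
  rw [cylCompose, ofMap_face, ContinuousMap.comp_assoc, cylAff_comp_stdFace]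
  rfl

/-- Naturality of `cylCompose` in the first factor. [folklore] -/
lemma cylCompose_prodMap (h : C(StdSimplex n × StdSimplex 1, X)) (f : Fin (m + 1) → Fin (n + 1))
    (w : Fin (k + 1) → Fin (m + 1) × Fin 2) :
    cylCompose h (Prod.map f id ∘ w) = cylCompose (h.comp (cylMap f)) w := by
  rw [cylCompose, cylCompose, cylAff_prodMap, ContinuousMap.comp_assoc]

/-- Realization of prism tuple chains against `h : Δⁿ × Δ¹ → X`: `[w] ↦ h ∘ [w]`, `ℤ`-linearly. [folklore] -/
def realizeCyl (h : C(StdSimplex n × StdSimplex 1, X)) (k : ℕ) :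
    TupleChain (Fin (n + 1) × Fin 2) k →ₗ[ℤ] CChain ℤ X k :=
  Finsupp.lmapDomain ℤ ℤ (cylCompose h)

/-- Realization of an elementary prism tuple chain. [folklore] -/
@[simp] lemma realizeCyl_single (h : C(StdSimplex n × StdSimplex 1, X)) (w : Fin (k + 1) → Fin (n + 1) × Fin 2)
    (c : ℤ) : realizeCyl h k (Finsupp.single w c) = Finsupp.single (cylCompose h w) c := by
  simp [realizeCyl]

/-- Realization commutes with boundaries. [folklore] -/
lemma bd_realizeCyl (h : C(StdSimplex n × StdSimplex 1, X)) (c : TupleChain (Fin (n + 1) × Fin 2) (k + 1)) :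
    csingularChainComplex.bd ℤ k (realizeCyl h (k + 1) c) = realizeCyl h k (TupleChain.bd k c) := by
  induction c using Finsupp.induction_linear with
  | zero => simp
  | add x y hx hy => simp only [map_add, hx, hy]
  | single w z =>
    rw [realizeCyl_single, csingularChainComplex.bd_single, TupleChain.bd_single, map_sum]
    refine Finset.sum_congr rfl fun i _ => ?_
    rw [map_zsmul, realizeCyl_single, cylCompose_face]

/-- Realization is natural in the first factor: realizing a pushed-forward tuple chain is realizing
against `h ∘ (f × 1)`. [folklore] -/
lemma realizeCyl_push (h : C(StdSimplex n × StdSimplex 1, X)) (f : Fin (m + 1) → Fin (n + 1))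
    (c : TupleChain (Fin (m + 1) × Fin 2) k) :
    realizeCyl h k (push (Prod.map f id) k c) = realizeCyl (h.comp (cylMap f)) k c := by
  induction c using Finsupp.induction_linear with
  | zero => simp
  | add x y hx hy => simp only [map_add, hx, hy]
  | single w z => rw [push_single, realizeCyl_single, realizeCyl_single, cylCompose_prodMap]

/-- `stdSimplex.map` along a constant map is the constant map to the vertex. [folklore] -/
lemma stdSimplex_map_const (b : Fin 2) (u : StdSimplex k) :
    stdSimplex.map (fun _ : Fin (k + 1) => b) u = stdSimplex.vertex b := by
  ext b'
  simp only [stdSimplex.map_coe, stdSimplex.vertex_coe, Pi.single_apply]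
  rw [FunOnFinite.linearMap_apply_apply]
  by_cases hb : b' = b
  · subst hb
    simp
  · simp [hb, Ne.symm hb]

/-- The end `h(·, e_b)` of `h : Δⁿ × Δ¹ → X` at the vertex `e_b` of `Δ¹`, as a singular simplex. [folklore] -/
def cylEnd (h : C(StdSimplex n × StdSimplex 1, X)) (b : Fin 2) : SingularSimplex X n :=
  ofMap (h.comp ⟨fun t => (t, stdSimplex.vertex b), by fun_prop⟩)

/-- Realizing the top/bottom copy of the identity tuple gives the top/bottom end of `h`. [folklore] -/
lemma cylCompose_liftV (h : C(StdSimplex n × StdSimplex 1, X)) (b : Fin 2) :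
    cylCompose h (liftV b) = cylEnd h b := by
  rw [cylCompose, cylEnd]
  congr 1
  ext u : 1
  change h (cylAff (liftV b) u) = h (u, stdSimplex.vertex b)
  congr 1
  refine Prod.ext ?_ ?_
  · change stdSimplex.map (fun j : Fin (n + 1) => j) u = u
    exact stdSimplex.map_id_apply u
  · exact stdSimplex_map_const b u

end Cylinder

/-! ### Affine simplices, straightening, the straight-line homotopy and the prism operator -/

section Vertices

open SingularSimplex

variable {E : Type u} [TopologicalSpace E] {n : ℕ}

/-- The vertices `τ(e₀), …, τ(eₙ)` of a singular simplex. [folklore] -/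
def vtx (τ : SingularSimplex E n) (j : Fin (n + 1)) : E := toContinuousMap τ (stdSimplex.vertex j)

/-- Vertices of a face: `(τ ∘ δᵢ)(eⱼ) = τ(e_{δᵢ j})`. [folklore] -/
lemma vtx_face (τ : SingularSimplex E (n + 1)) (i : Fin (n + 2)) (j : Fin (n + 1)) :
    vtx (τ.face i) j = vtx τ (Fin.succAbove i j) := by
  rw [vtx, vtx, toContinuousMap_face_apply, stdFace_apply, stdSimplex.map_vertex]

end Vertices

section LinAlg

variable {E : Type u} [AddCommGroup E] [Module ℝ E] {n k : ℕ}

/-- Re-indexing a weighted sum along `stdSimplex.map`: `∑ⱼ (f_* u)ⱼ • pⱼ = ∑ᵢ uᵢ • p_{f i}`. [folklore] -/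
lemma sum_stdSimplex_map_smul (f : Fin (k + 1) → Fin (n + 1)) (u : StdSimplex k) (p : Fin (n + 1) → E) :
    ∑ j, (stdSimplex.map f u) j • p j = ∑ i, u i • p (f i) := by
  simp only [stdSimplex.map_coe]
  rw [← Finset.sum_fiberwise Finset.univ f (fun i => u i • p (f i))]
  refine Finset.sum_congr rfl fun j _ => ?_
  rw [FunOnFinite.linearMap_apply_apply, Finset.sum_smul]
  refine Finset.sum_congr rfl fun i hi => ?_
  rw [(Finset.mem_filter.mp hi).2]

end LinAlg

section Affine

open TupleChain SingularSimplex

variable {E : Type u} [AddCommGroup E] [Module ℝ E] [TopologicalSpace E] [IsTopologicalAddGroup E]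
  [ContinuousSMul ℝ E] {n k : ℕ}

/-- The **affine singular simplex** `[p₀, …, pₙ] : Δⁿ → E`, `t ↦ ∑ⱼ tⱼ pⱼ` (Hatcher 2002, §2.1,
linear simplices). [folklore] -/
def affSimplex (p : Fin (n + 1) → E) : SingularSimplex E n :=
  ofMap ⟨fun t : StdSimplex n => ∑ j, t j • p j,
    continuous_finsetSum _ fun j _ =>
      ((continuous_apply j).comp continuous_subtype_val).smul continuous_const⟩

/-- Values of an affine simplex. [folklore] -/
@[simp] lemma affSimplex_apply (p : Fin (n + 1) → E) (t : StdSimplex n) :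
    toContinuousMap (affSimplex p) t = ∑ j, t j • p j := by
  rw [affSimplex, toContinuousMap_ofMap]
  rfl

/-- Faces of affine simplices: `[p] ∘ δᵢ = [p ∘ δᵢ]`. [folklore] -/
lemma affSimplex_face (p : Fin (n + 2) → E) (i : Fin (n + 2)) :
    (affSimplex p).face i = affSimplex (p ∘ Fin.succAbove i) := by
  apply toContinuousMap_injective
  ext t : 1
  rw [toContinuousMap_face_apply, affSimplex_apply, affSimplex_apply, stdFace_apply,
    sum_stdSimplex_map_smul]
  rfl

/-- **Straightening** of a singular simplex along a vertex map `r : E → E`: the affine simplex on the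
moved vertices `r(τ e₀), …, r(τ eₙ)` (Hatcher 2002, §2.1; `r` will round vertices to rational points). [folklore] -/
def str (r : E → E) (τ : SingularSimplex E n) : SingularSimplex E n :=
  affSimplex fun j => r (vtx τ j)

/-- Straightening commutes with faces. [folklore] -/
lemma str_face (r : E → E) (τ : SingularSimplex E (n + 1)) (i : Fin (n + 2)) :
    (str r τ).face i = str r (τ.face i) := by
  rw [str, affSimplex_face, str]
  congr 1
  funext j
  simp only [Function.comp_apply, vtx_face]

/-- Straightening of chains (`ℤ`-linear extension of `str r`). [folklore] -/
def strOp (r : E → E) (n : ℕ) : CChain ℤ E n →ₗ[ℤ] CChain ℤ E n :=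
  Finsupp.lmapDomain ℤ ℤ (str r)

/-- Straightening of an elementary chain. [folklore] -/
@[simp] lemma strOp_single (r : E → E) (τ : SingularSimplex E n) (m : ℤ) :
    strOp r n (Finsupp.single τ m) = Finsupp.single (str r τ) m := by
  simp [strOp]

/-- Straightening is a chain map: `∂ ∘ str = str ∘ ∂`. [folklore] -/
lemma bd_strOp (r : E → E) (c : CChain ℤ E (n + 1)) :
    csingularChainComplex.bd ℤ n (strOp r (n + 1) c) = strOp r n (csingularChainComplex.bd ℤ n c) := by
  induction c using Finsupp.induction_linear with
  | zero => simp
  | add x y hx hy => simp only [map_add, hx, hy]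
  | single τ m =>
    rw [strOp_single, csingularChainComplex.bd_single, csingularChainComplex.bd_single, map_sum]
    refine Finset.sum_congr rfl fun i _ => ?_
    rw [map_zsmul, strOp_single, str_face]

/-- The **straight-line homotopy** `Δⁿ × Δ¹ → E`, `(t, b) ↦ b₀ τ₀(t) + b₁ τ₁(t)` between two singular
simplices of a real vector space. [folklore] -/
def lineHtpy (τ₀ τ₁ : SingularSimplex E n) : C(StdSimplex n × StdSimplex 1, E) where
  toFun q := (q.2 0) • toContinuousMap τ₀ q.1 + (q.2 1) • toContinuousMap τ₁ q.1
  continuous_toFun :=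
    (((continuous_apply 0).comp (continuous_subtype_val.comp continuous_snd)).smul
      ((map_continuous _).comp continuous_fst)).add
      (((continuous_apply 1).comp (continuous_subtype_val.comp continuous_snd)).smul
        ((map_continuous _).comp continuous_fst))

/-- The straight-line homotopy as a function. [folklore] -/
@[simp] lemma lineHtpy_apply (τ₀ τ₁ : SingularSimplex E n) (q : StdSimplex n × StdSimplex 1) :
    lineHtpy τ₀ τ₁ q = (q.2 0) • toContinuousMap τ₀ q.1 + (q.2 1) • toContinuousMap τ₁ q.1 := rfl

/-- The bottom end of the straight-line homotopy is `τ₀`. [folklore] -/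
lemma cylEnd_lineHtpy_zero (τ₀ τ₁ : SingularSimplex E n) : cylEnd (lineHtpy τ₀ τ₁) 0 = τ₀ := by
  apply toContinuousMap_injective
  rw [cylEnd, toContinuousMap_ofMap]
  ext t : 1
  change ((stdSimplex.vertex (S := ℝ) (0 : Fin 2)) 0) • toContinuousMap τ₀ t +
    ((stdSimplex.vertex (S := ℝ) (0 : Fin 2)) 1) • toContinuousMap τ₁ t = toContinuousMap τ₀ t
  simp

/-- The top end of the straight-line homotopy is `τ₁`. [folklore] -/
lemma cylEnd_lineHtpy_one (τ₀ τ₁ : SingularSimplex E n) : cylEnd (lineHtpy τ₀ τ₁) 1 = τ₁ := by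
  apply toContinuousMap_injective
  rw [cylEnd, toContinuousMap_ofMap]
  ext t : 1
  change ((stdSimplex.vertex (S := ℝ) (1 : Fin 2)) 0) • toContinuousMap τ₀ t +
    ((stdSimplex.vertex (S := ℝ) (1 : Fin 2)) 1) • toContinuousMap τ₁ t = toContinuousMap τ₁ t
  simp

/-- The straight-line homotopy restricted over a face is the straight-line homotopy of the faces. [folklore] -/
lemma lineHtpy_comp_cylMap (τ₀ τ₁ : SingularSimplex E (n + 1)) (i : Fin (n + 2)) :
    (lineHtpy τ₀ τ₁).comp (cylMap (Fin.succAbove i)) = lineHtpy (τ₀.face i) (τ₁.face i) := by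
  ext q : 1
  change (q.2 0) • toContinuousMap τ₀ (stdSimplex.map (Fin.succAbove i) q.1) +
      (q.2 1) • toContinuousMap τ₁ (stdSimplex.map (Fin.succAbove i) q.1) =
    (q.2 0) • toContinuousMap (τ₀.face i) q.1 + (q.2 1) • toContinuousMap (τ₁.face i) q.1
  rw [toContinuousMap_face_apply, toContinuousMap_face_apply]
  rfl

/-- The identity tuple `[0, 1, …, n]` of the combinatorial `n`-simplex. [folklore] -/
def baseT (n : ℕ) : TupleChain (Fin (n + 1)) n := Finsupp.single id 1

/-- The **prism operator** `P : Cₙ(E) → Cₙ₊₁(E)` of the straight-line homotopies from each simplex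
to its straightening: `P τ = (h_τ)♯ (prism of Δⁿ)`, `h_τ = lineHtpy τ (str r τ)` (Hatcher 2002,
proof of Thm. 2.10, with the affine prism decomposition of `Δⁿ × I`). [folklore] -/
def prismOp (r : E → E) (n : ℕ) : CChain ℤ E n →ₗ[ℤ] CChain ℤ E (n + 1) :=
  Finsupp.lsum ℤ fun τ =>
    LinearMap.id.smulRight (realizeCyl (lineHtpy τ (str r τ)) (n + 1) (prismT n (baseT n)))

/-- The prism operator on an elementary chain. [folklore] -/
lemma prismOp_single (r : E → E) (τ : SingularSimplex E n) (m : ℤ) :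
    prismOp r n (Finsupp.single τ m) =
      m • realizeCyl (lineHtpy τ (str r τ)) (n + 1) (prismT n (baseT n)) := by
  simp [prismOp]

/-- Naturality of the prism pieces under faces: the prism of `Δⁿ⁺¹` realized over the `i`-th face
tuple is the prism operator of the `i`-th face. [folklore] -/
lemma realizeCyl_prismT_single_succAbove (r : E → E) (τ : SingularSimplex E (n + 1)) (i : Fin (n + 2)) :
    realizeCyl (lineHtpy τ (str r τ)) (n + 1) (prismT n (Finsupp.single (Fin.succAbove i) 1)) =
      realizeCyl (lineHtpy (τ.face i) (str r (τ.face i))) (n + 1) (prismT n (baseT n)) := by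
  have h1 : (Finsupp.single (Fin.succAbove i) 1 : TupleChain (Fin (n + 2)) n) =
      push (Fin.succAbove i) n (baseT n) := by
    rw [baseT, push_single, Function.comp_id]
  rw [h1, ← push_prismT, realizeCyl_push, lineHtpy_comp_cylMap, str_face]

/-- **Prism formula for the prism operator**, positive degrees:
`∂ P c = str c - c - P ∂ c` (Hatcher 2002, proof of Thm. 2.10). [folklore] -/
theorem bd_prismOp_succ (r : E → E) (c : CChain ℤ E (n + 1)) :
    csingularChainComplex.bd ℤ (n + 1) (prismOp r (n + 1) c) =
      strOp r (n + 1) c - c - prismOp r n (csingularChainComplex.bd ℤ n c) := by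
  induction c using Finsupp.induction_linear with
  | zero => simp
  | add x y hx hy => simp only [map_add, hx, hy]; abel
  | single τ m =>
    rw [prismOp_single, map_zsmul, bd_realizeCyl, bd_prismT_succ, baseT, push_single, push_single,
      Function.comp_id, Function.comp_id, bd_single, map_sub, map_sub, realizeCyl_single,
      realizeCyl_single, cylCompose_liftV, cylCompose_liftV, cylEnd_lineHtpy_zero, cylEnd_lineHtpy_one,
      map_sum, map_sum, strOp_single, csingularChainComplex.bd_single, map_sum]
    simp only [Function.id_comp, map_zsmul, prismOp_single, smul_sub, Finsupp.smul_single_one,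
      Finset.smul_sum]
    congr 1
    refine Finset.sum_congr rfl fun i _ => ?_
    rw [← Finsupp.smul_single_one, map_zsmul, map_zsmul, realizeCyl_prismT_single_succAbove, smul_comm]

/-- Prism formula in degree `0`: `∂ P c = str c - c`. [folklore] -/
theorem bd_prismOp_zero (r : E → E) (c : CChain ℤ E 0) :
    csingularChainComplex.bd ℤ 0 (prismOp r 0 c) = strOp r 0 c - c := by
  induction c using Finsupp.induction_linear with
  | zero => simp
  | add x y hx hy => simp only [map_add, hx, hy]; abel
  | single τ m =>
    rw [prismOp_single, map_zsmul, bd_realizeCyl, bd_prismT_zero, baseT, push_single, push_single,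
      Function.comp_id, Function.comp_id, map_sub, realizeCyl_single, realizeCyl_single,
      cylCompose_liftV, cylCompose_liftV, cylEnd_lineHtpy_zero, cylEnd_lineHtpy_one, strOp_single,
      smul_sub, Finsupp.smul_single_one, Finsupp.smul_single_one]

end Affine

/-! ### Small simplices of `ℝ^N`: balls, rounding to rational points, supports -/

section Small

open Metric SingularSimplex

variable {N : ℕ}

/-- `∂ ∂ = 0` on concrete singular chains (element form of `d_comp_d`). [folklore] -/
lemma bd_bd {X : Type u} [TopologicalSpace X] (q : ℕ) (c : CChain ℤ X (q + 2)) :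
    csingularChainComplex.bd ℤ q (csingularChainComplex.bd ℤ (q + 1) c) = 0 := by
  have h := (csingularChainComplex ℤ ℤ X).d_comp_d (q + 2) (q + 1) q
  have h' := congrArg (fun φ => (ModuleCat.Hom.hom φ) c) h
  simp only [ModuleCat.hom_comp, LinearMap.comp_apply] at h'
  rw [← csingularChainComplex.d_apply, ← csingularChainComplex.d_apply]
  exact h'

/-- A chain is `𝒰`-small iff each of its simplices lies in some `Uᵢ` (Hatcher 2002, Prop. 2.21). [folklore] -/
lemma mem_smallChains_iff' {X : Type u} [TopologicalSpace X] {ι : Type*} (U : ι → Set X) {n : ℕ}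
    (c : CChain ℤ X n) : c ∈ smallChains ℤ ℤ X U n ↔ ∀ σ ∈ c.support, ∃ i, σ.range ⊆ U i := by
  have h : smallChains ℤ ℤ X U n = Finsupp.supported ℤ ℤ (⋃ i, simplicesIn X (U i) n) := by
    rw [smallChains, Finsupp.supported_iUnion]
    rfl
  rw [h, Finsupp.mem_supported']
  constructor
  · intro hc σ hσ
    by_contra hne
    exact (Finsupp.mem_support_iff.mp hσ) (hc σ fun hmem => hne (Set.mem_iUnion.mp hmem))
  · intro hc σ hσ
    by_contra hcσ
    exact hσ (Set.mem_iUnion.mpr (hc σ (Finsupp.mem_support_iff.mpr hcσ)))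

/-- Index set of the cover of an open `U ⊆ ℝ^N` by balls `B(x, ρ)` with `B(x, 2ρ) ⊆ U`. [folklore] -/
def BallIdx (U : Set (Fin N → ℝ)) : Type :=
  {p : (Fin N → ℝ) × ℝ // 0 < p.2 ∧ ball p.1 (2 * p.2) ⊆ U}

/-- The cover of `U` by the balls `B(x, ρ)` with `B(x, 2ρ) ⊆ U`. [folklore] -/
def ballCover (U : Set (Fin N → ℝ)) : BallIdx U → Set (Fin N → ℝ) := fun i => ball i.1.1 i.1.2

/-- The balls of the cover are open. [folklore] -/
lemma isOpen_ballCover (U : Set (Fin N → ℝ)) (i : BallIdx U) : IsOpen (ballCover U i) := isOpen_ball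

/-- The half-size balls cover `U`. [folklore] -/
lemma subset_iUnion_ballCover {U : Set (Fin N → ℝ)} (hU : IsOpen U) : U ⊆ ⋃ i, ballCover U i := by
  intro x hx
  obtain ⟨ε, hε, hεU⟩ := Metric.isOpen_iff.mp hU x hx
  refine Set.mem_iUnion.mpr ⟨⟨(x, ε / 2), by positivity, ?_⟩, mem_ball_self (by positivity)⟩
  convert hεU using 2
  ring

/-- Rounding to rational points: for `ε > 0` there is a map `ℝ^N → ℚ^N` moving every point by less
than `ε` (density of `ℚ` in `ℝ`, coordinatewise, sup metric). [folklore] -/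
lemma exists_rat_rounding (N : ℕ) {ε : ℝ} (hε : 0 < ε) :
    ∃ rq : (Fin N → ℝ) → (Fin N → ℚ), ∀ y, dist (fun i => ((rq y i : ℚ) : ℝ)) y < ε := by
  have h : ∀ x : ℝ, ∃ q : ℚ, dist (q : ℝ) x < ε := fun x => by
    obtain ⟨q, hq1, hq2⟩ := exists_rat_btwn (show x - ε < x + ε by linarith)
    refine ⟨q, ?_⟩
    rw [Real.dist_eq, abs_sub_lt_iff]
    constructor <;> linarith
  choose f hf using h
  refine ⟨fun y i => f (y i), fun y => ?_⟩
  rw [dist_pi_lt_iff hε]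
  exact fun i => hf (y i)

/-- A finite family of positive reals has a positive lower bound. [folklore] -/
lemma exists_pos_le_of_forall_pos {α : Type*} (s : Finset α) (f : α → ℝ) (h : ∀ a ∈ s, 0 < f a) :
    ∃ ε : ℝ, 0 < ε ∧ ∀ a ∈ s, ε ≤ f a := by
  rcases s.eq_empty_or_nonempty with rfl | hs
  · exact ⟨1, one_pos, by simp⟩
  · exact ⟨s.inf' hs f, (Finset.lt_inf'_iff hs).mpr h, fun a ha => Finset.inf'_le f ha⟩

variable {n : ℕ}

/-- Affine simplices on points of a convex set lie in it. [folklore] -/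
lemma range_affSimplex_subset {C : Set (Fin N → ℝ)} (hC : Convex ℝ C) {p : Fin (n + 1) → Fin N → ℝ}
    (hp : ∀ j, p j ∈ C) : (affSimplex p).range ⊆ C := by
  rintro _ ⟨t, rfl⟩
  rw [affSimplex_apply]
  exact hC.sum_mem (fun j _ => t.2.1 j) t.2.2 fun j _ => hp j

/-- Prism pieces of the straight-line homotopy between two simplices of a convex set lie in it. [folklore] -/
lemma range_cylCompose_lineHtpy_subset {k : ℕ} {C : Set (Fin N → ℝ)} (hC : Convex ℝ C)
    {τ₀ τ₁ : SingularSimplex (Fin N → ℝ) n} (h₀ : τ₀.range ⊆ C) (h₁ : τ₁.range ⊆ C)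
    (w : Fin (k + 1) → Fin (n + 1) × Fin 2) : (cylCompose (lineHtpy τ₀ τ₁) w).range ⊆ C := by
  rintro _ ⟨u, rfl⟩
  rw [cylCompose, toContinuousMap_ofMap, ContinuousMap.comp_apply, lineHtpy_apply]
  exact hC (h₀ ⟨_, rfl⟩) (h₁ ⟨_, rfl⟩) ((cylAff w u).2.2.1 0) ((cylAff w u).2.2.1 1)
    (stdSimplex.add_eq_one _)

/-- Realized prism chains lie in any set containing all prism pieces. [folklore] -/
lemma realizeCyl_mem_chainsIn {k : ℕ} {C : Set (Fin N → ℝ)} {h : C(StdSimplex n × StdSimplex 1, Fin N → ℝ)}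
    (hh : ∀ w : Fin (k + 1) → Fin (n + 1) × Fin 2, (cylCompose h w).range ⊆ C)
    (c : TupleChain (Fin (n + 1) × Fin 2) k) : realizeCyl h k c ∈ chainsIn ℤ ℤ (Fin N → ℝ) C k := by
  induction c using Finsupp.induction_linear with
  | zero => simp
  | add x y hx hy => rw [map_add]; exact Submodule.add_mem _ hx hy
  | single w z => rw [realizeCyl_single]; exact single_mem_chainsIn ℤ ℤ (hh w) z

/-- **Local straightening stays in `U`.** If `τ` lies in `B(x, ρ)`, `B(x, 2ρ) ⊆ U` and `r` moves
points by less than `ρ`, then the straightened simplex `str r τ` and all prism pieces of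
`P τ` lie in the convex ball `B(x, 2ρ) ⊆ U` (Warner 1983, 5.32 / Huber 2023, proof of Thm. 4.7: the
cone construction inside a ball; here in prism form). [folklore] -/
lemma str_prism_subset {U : Set (Fin N → ℝ)} {x : Fin N → ℝ} {ρ : ℝ} (hU : ball x (2 * ρ) ⊆ U)
    {τ : SingularSimplex (Fin N → ℝ) n} (hτ : τ.range ⊆ ball x ρ) {r : (Fin N → ℝ) → Fin N → ℝ}
    (hr : ∀ y, dist (r y) y < ρ) :
    (str r τ).range ⊆ U ∧ ∀ m, prismOp r n (Finsupp.single τ m) ∈ chainsIn ℤ ℤ (Fin N → ℝ) U (n + 1) := by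
  have hρ : 0 ≤ ρ := (dist_nonneg.trans_lt (hr 0)).le
  have hv : ∀ j, r (vtx τ j) ∈ ball x (2 * ρ) := fun j => by
    have h1 : vtx τ j ∈ ball x ρ := hτ ⟨_, rfl⟩
    rw [mem_ball] at h1 ⊢
    calc dist (r (vtx τ j)) x ≤ dist (r (vtx τ j)) (vtx τ j) + dist (vtx τ j) x := dist_triangle _ _ _
      _ < ρ + ρ := add_lt_add (hr _) h1
      _ = 2 * ρ := by ring
  have hstr : (str r τ).range ⊆ ball x (2 * ρ) := range_affSimplex_subset (convex_ball x _) hv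
  have hτ' : τ.range ⊆ ball x (2 * ρ) := hτ.trans (ball_subset_ball (by linarith))
  refine ⟨hstr.trans hU, fun m => ?_⟩
  rw [prismOp_single]
  exact Submodule.smul_mem _ _ (chainsIn_mono ℤ ℤ hU _
    (realizeCyl_mem_chainsIn (range_cylCompose_lineHtpy_subset (convex_ball x _) hτ' hstr) _))

/-- A uniform rounding radius for a finite set of small simplices. [folklore] -/
lemma exists_radius {U : Set (Fin N → ℝ)} (T : Finset (SingularSimplex (Fin N → ℝ) n))
    (hT : ∀ τ ∈ T, ∃ i : BallIdx U, τ.range ⊆ ballCover U i) :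
    ∃ ε : ℝ, 0 < ε ∧ ∀ r : (Fin N → ℝ) → Fin N → ℝ, (∀ y, dist (r y) y < ε) → ∀ τ ∈ T,
      (str r τ).range ⊆ U ∧
        ∀ m, prismOp r n (Finsupp.single τ m) ∈ chainsIn ℤ ℤ (Fin N → ℝ) U (n + 1) := by
  classical
  choose ι hι using hT
  obtain ⟨ε, hε, hle⟩ := exists_pos_le_of_forall_pos T
    (fun τ => if h : τ ∈ T then (ι τ h).1.2 else 1) fun τ hτ => by
      simp only [dif_pos hτ]
      exact (ι τ hτ).2.1
  refine ⟨ε, hε, fun r hr τ hτ => ?_⟩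
  have hle' := hle τ hτ
  simp only [dif_pos hτ] at hle'
  exact str_prism_subset (ι τ hτ).2.2 (hι τ hτ) fun y => (hr y).trans_le hle'

/-- Linear extension: straightening and prisms of a chain all of whose simplices are good stay in `U`. [folklore] -/
lemma strOp_prismOp_mem_chainsIn {U : Set (Fin N → ℝ)} {r : (Fin N → ℝ) → Fin N → ℝ}
    (c : CChain ℤ (Fin N → ℝ) n)
    (hc : ∀ τ ∈ c.support, (str r τ).range ⊆ U ∧
      ∀ m, prismOp r n (Finsupp.single τ m) ∈ chainsIn ℤ ℤ (Fin N → ℝ) U (n + 1)) :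
    strOp r n c ∈ chainsIn ℤ ℤ (Fin N → ℝ) U n ∧ prismOp r n c ∈ chainsIn ℤ ℤ (Fin N → ℝ) U (n + 1) := by
  constructor
  · rw [← Finsupp.sum_single c, Finsupp.sum, map_sum]
    refine Submodule.sum_mem _ fun τ hτ => ?_
    rw [strOp_single]
    exact single_mem_chainsIn ℤ ℤ (hc τ hτ).1 _
  · rw [← Finsupp.sum_single c, Finsupp.sum, map_sum]
    exact Submodule.sum_mem _ fun τ hτ => (hc τ hτ).2 _

end Small

/-! ### The homological skeleton: subcomplexes closed under straightening, subdivision and prisms -/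

section Assembly

open Metric

variable {N : ℕ}

/-- **Elementwise quasi-isomorphism from closure properties.** Let `U ⊆ ℝ^N` be open and `A_•` a
family of subgroups of singular chains of `ℝ^N` which (1) contains the straightenings `str r c`
of all chains along rational-valued vertex maps `r`, (2) is stable under iterated barycentric
subdivision `Sʲ` and the chain homotopies `Dⱼ`, and (3) is stable under the prism operators `P_r`
of rational-valued `r`. Then `S_•(U) ∩ A_•` computes `H_•(U; ℤ)` (`ComputesHomologyIn U A`):
(i) for a cycle `z`, `z - str (Sʲ z) = ∂ (Dⱼ z - P (Sʲ z))`; (ii) for `a = ∂ c` in `A`,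
`a = ∂ (Dⱼ a - P (Sʲ a) + str (Sʲ c))`, with `j` large (Lebesgue number) and `r` a rounding to
`ℚ^N` finer than the balls (Hatcher 2002, proofs of Prop. 2.21 and Thm. 2.10; Warner 1983, 5.32). [folklore] -/
theorem computesHomologyIn_of_closure (U : Set (Fin N → ℝ)) (hU : IsOpen U)
    (A : (d : ℕ) → Submodule ℤ (CChain ℤ (Fin N → ℝ) d))
    (hA1 : ∀ (d : ℕ) (rq : (Fin N → ℝ) → Fin N → ℚ) (c : CChain ℤ (Fin N → ℝ) d),
      strOp (fun y i => ((rq y i : ℚ) : ℝ)) d c ∈ A d)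
    (hA2 : ∀ (d j : ℕ) (a : CChain ℤ (Fin N → ℝ) d), a ∈ A d → ((sdX ℤ ℤ d) ^ j) a ∈ A d)
    (hA2' : ∀ (d j : ℕ) (a : CChain ℤ (Fin N → ℝ) d), a ∈ A d → sdhSum ℤ ℤ j d a ∈ A (d + 1))
    (hA3 : ∀ (d : ℕ) (rq : (Fin N → ℝ) → Fin N → ℚ) (a : CChain ℤ (Fin N → ℝ) d), a ∈ A d →
      prismOp (fun y i => ((rq y i : ℚ) : ℝ)) d a ∈ A (d + 1)) :
    ComputesHomologyIn U A := by
  have hcov : ∀ (d : ℕ) (c : CChain ℤ (Fin N → ℝ) d), c ∈ chainsIn ℤ ℤ (Fin N → ℝ) U d →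
      ∃ j : ℕ, ((sdX ℤ ℤ d) ^ j) c ∈ smallChains ℤ ℤ (Fin N → ℝ) (ballCover U) d := fun d c hc =>
    exists_sdX_pow_mem_smallChains ℤ ℤ (ballCover U) (isOpen_ballCover U)
      (chainsIn_mono ℤ ℤ (subset_iUnion_ballCover hU) d hc)
  have hsmall : ∀ (d : ℕ) (c : CChain ℤ (Fin N → ℝ) d),
      c ∈ smallChains ℤ ℤ (Fin N → ℝ) (ballCover U) d →
        ∀ τ ∈ c.support, ∃ i : BallIdx U, τ.range ⊆ ballCover U i := fun d c hc =>
    (mem_smallChains_iff' (ballCover U) c).mp hc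
  constructor
  · -- (i) every cycle is homologous to a straightened (hence `A`-) cycle
    intro d z hz hcyc
    obtain ⟨j, hj⟩ := hcov d z hz
    set z' := ((sdX ℤ ℤ d) ^ j) z with hz'
    obtain ⟨ε, hε, hεP⟩ := exists_radius z'.support (hsmall d z' hj)
    obtain ⟨rq, hrq⟩ := exists_rat_rounding N hε
    set r : (Fin N → ℝ) → Fin N → ℝ := fun y i => ((rq y i : ℚ) : ℝ) with hr
    obtain ⟨hsU, hpU⟩ := strOp_prismOp_mem_chainsIn z' (hεP r hrq)
    refine ⟨strOp r d z', ⟨hsU, hA1 d rq z'⟩, sdhSum ℤ ℤ j d z - prismOp r d z',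
      Submodule.sub_mem _ (sdhSum_mem_chainsIn j hz) hpU, ?_⟩
    cases d with
    | zero =>
      rw [map_sub, bd_sdhSum_zero, bd_prismOp_zero, hz', sdX_pow_zero_apply]
      abel
    | succ d =>
      have hcyc' : csingularChainComplex.bd ℤ d z = 0 := hcyc
      have h1 := bd_sdhSum_add_sdhSum_bd (R := ℤ) (M := ℤ) j z
      rw [hcyc', map_zero, add_zero] at h1
      have h3 : csingularChainComplex.bd ℤ d z' = 0 := by rw [hz', ← sdX_pow_bd, hcyc', map_zero]
      rw [map_sub, h1, bd_prismOp_succ, h3, map_zero, sub_zero]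
      abel
  · -- (ii) an `A`-cycle bounding in `U` bounds an `A`-chain in `U`
    rintro d a ⟨haU, haA⟩ ⟨c, hcU, hca⟩
    obtain ⟨j, hj⟩ := hcov (d + 1) c hcU
    set c' := ((sdX ℤ ℤ (d + 1)) ^ j) c with hc'
    set a' := ((sdX ℤ ℤ d) ^ j) a with ha'
    have ha'eq : csingularChainComplex.bd ℤ d c' = a' := by rw [hc', ha', ← sdX_pow_bd, hca]
    have hj' : a' ∈ smallChains ℤ ℤ (Fin N → ℝ) (ballCover U) d :=
      ha'eq ▸ bd_mem_smallChains ℤ ℤ (ballCover U) hj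
    obtain ⟨ε₁, hε₁, hε₁P⟩ := exists_radius c'.support (hsmall (d + 1) c' hj)
    obtain ⟨ε₂, hε₂, hε₂P⟩ := exists_radius a'.support (hsmall d a' hj')
    obtain ⟨rq, hrq⟩ := exists_rat_rounding N (lt_min hε₁ hε₂)
    set r : (Fin N → ℝ) → Fin N → ℝ := fun y i => ((rq y i : ℚ) : ℝ) with hr
    obtain ⟨hsUc, -⟩ := strOp_prismOp_mem_chainsIn c'
      (hε₁P r (fun y => (hrq y).trans_le (min_le_left _ _)))
    obtain ⟨-, hpUa⟩ := strOp_prismOp_mem_chainsIn a'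
      (hε₂P r (fun y => (hrq y).trans_le (min_le_right _ _)))
    refine ⟨sdhSum ℤ ℤ j d a - prismOp r d a' + strOp r (d + 1) c', ⟨?_, ?_⟩, ?_⟩
    · exact Submodule.add_mem _ (Submodule.sub_mem _ (sdhSum_mem_chainsIn j haU) hpUa) hsUc
    · exact Submodule.add_mem _ (Submodule.sub_mem _ (hA2' d j a haA) (hA3 d rq a' (hA2 d j a haA)))
        (hA1 (d + 1) rq c')
    · cases d with
      | zero =>
        rw [map_add, map_sub, bd_sdhSum_zero, bd_prismOp_zero, bd_strOp, ha'eq, ha',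
          sdX_pow_zero_apply]
        abel
      | succ d =>
        have hbda : csingularChainComplex.bd ℤ d a = 0 := by rw [← hca, bd_bd]
        have h1 := bd_sdhSum_add_sdhSum_bd (R := ℤ) (M := ℤ) j a
        rw [hbda, map_zero, add_zero] at h1
        have h3 : csingularChainComplex.bd ℤ d a' = 0 := by rw [ha', ← sdX_pow_bd, hbda, map_zero]
        rw [map_add, map_sub, h1, bd_prismOp_succ, h3, map_zero, sub_zero, bd_strOp, ha'eq]
        abel

end Assembly

/-! ### Rationality of the vertices of `Sʲ Δⁿ` and `T Sⁱ Δⁿ` -/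

section RatTuples

open TupleChain StdSimplex

/-- A point of `Δⁿ` is **rational** if all its barycentric coordinates are rational numbers. [folklore] -/
def IsRatPt {n : ℕ} (p : StdSimplex n) : Prop := ∀ i, ∃ q : ℚ, p i = (q : ℝ)

/-- The rational points of `Δⁿ`. [folklore] -/
abbrev RatPts (n : ℕ) : Type := {p : StdSimplex n // IsRatPt p}

/-- The vertices of `Δⁿ` are rational points. [folklore] -/
lemma isRatPt_vertex {n : ℕ} (j : Fin (n + 1)) : IsRatPt (stdSimplex.vertex (S := ℝ) j) := fun i => by
  by_cases h : i = j
  · exact ⟨1, by simp [h]⟩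
  · exact ⟨0, by simp [h]⟩

/-- Barycentres of rational points are rational. [folklore] -/
lemma isRatPt_sbary {n m : ℕ} (w : Fin (m + 1) → StdSimplex n) (hw : ∀ j, IsRatPt (w j)) :
    IsRatPt (sbary n m w) := fun i => by
  choose q hq using fun j => hw j i
  refine ⟨∑ j, ((m : ℚ) + 1)⁻¹ * q j, ?_⟩
  rw [sbary_apply]
  push_cast
  exact Finset.sum_congr rfl fun j _ => by rw [hq j]

/-- The barycentre operation restricted to rational points. [folklore] -/
def qbary (n : ℕ) : (m : ℕ) → (Fin (m + 1) → RatPts n) → RatPts n := fun m w =>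
  ⟨sbary n m (fun j => (w j).1), isRatPt_sbary _ fun j => (w j).2⟩

/-- The vertex tuple of `Δⁿ` as a tuple of rational points. [folklore] -/
def qVertexTuple (n : ℕ) : Fin (n + 1) → RatPts n := fun j => ⟨stdSimplex.vertex j, isRatPt_vertex j⟩

/-- Forgetting rationality, the rational vertex tuple is the vertex tuple. [folklore] -/
lemma push_val_qVertexTuple (n : ℕ) :
    push (Subtype.val : RatPts n → StdSimplex n) n (Finsupp.single (qVertexTuple n) 1) =
      Finsupp.single (vertexTuple n) 1 := by
  rw [push_single]
  rfl

/-- `Sⁱ Δⁿ` is the push-forward of the subdivision computed inside the rational points. [folklore] -/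
lemma sd_iterate_vertexTuple_eq_push (n i : ℕ) :
    (sd (sbary n) n)^[i] (Finsupp.single (vertexTuple n) 1) =
      push (Subtype.val : RatPts n → StdSimplex n) n
        ((sd (qbary n) n)^[i] (Finsupp.single (qVertexTuple n) 1)) := by
  induction i with
  | zero => rw [Function.iterate_zero, id, Function.iterate_zero, id, push_val_qVertexTuple]
  | succ i ih =>
    rw [Function.iterate_succ_apply', Function.iterate_succ_apply', ih,
      push_sd (qbary n) Subtype.val (sbary n) (fun _ _ => rfl)]

/-- Tuples of a pushed-forward chain from the rational points are rational. [folklore] -/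
lemma isRatPt_of_mem_support_push {n k : ℕ} {x : TupleChain (RatPts n) k} {w : Fin (k + 1) → StdSimplex n}
    (hw : w ∈ (push (Subtype.val : RatPts n → StdSimplex n) k x).support) (j : Fin (k + 1)) :
    IsRatPt (w j) := by
  classical
  rw [push, Finsupp.lmapDomain_apply] at hw
  obtain ⟨w', -, rfl⟩ := Finset.mem_image.mp (Finsupp.mapDomain_support hw)
  exact (w' j).2

/-- **The vertices of the simplices of `Sⁱ Δⁿ` are rational points.** [folklore] -/
lemma isRatPt_of_mem_support_sd_iterate {n i : ℕ} {w : Fin (n + 1) → StdSimplex n}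
    (hw : w ∈ ((sd (sbary n) n)^[i] (Finsupp.single (vertexTuple n) 1)).support) (j : Fin (n + 1)) :
    IsRatPt (w j) := by
  rw [sd_iterate_vertexTuple_eq_push] at hw
  exact isRatPt_of_mem_support_push hw j

/-- **The vertices of the simplices of `T Sⁱ Δⁿ` are rational points.** [folklore] -/
lemma isRatPt_of_mem_support_sdh_sd_iterate {n i : ℕ} {w : Fin (n + 2) → StdSimplex n}
    (hw : w ∈ (sdh (sbary n) n ((sd (sbary n) n)^[i] (Finsupp.single (vertexTuple n) 1))).support)
    (j : Fin (n + 2)) : IsRatPt (w j) := by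
  rw [sd_iterate_vertexTuple_eq_push, ← push_sdh (qbary n) Subtype.val (sbary n) (fun _ _ => rfl)] at hw
  exact isRatPt_of_mem_support_push hw j

end RatTuples

/-! ### From simplexwise closure properties to the chain-level hypotheses -/

section Simplexwise

open TupleChain SingularSimplex

variable {N : ℕ}

/-- Membership in a `Finsupp.supported` subgroup of chains is simplexwise. [folklore] -/
lemma mem_supported_iff_support {d : ℕ} (P : Set (SingularSimplex (Fin N → ℝ) d))
    (c : CChain ℤ (Fin N → ℝ) d) : c ∈ Finsupp.supported ℤ ℤ P ↔ ∀ σ ∈ c.support, σ ∈ P := by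
  rw [Finsupp.mem_supported']
  constructor
  · intro h σ hσ
    by_contra hs
    exact (Finsupp.mem_support_iff.mp hσ) (h σ hs)
  · intro h σ hσ
    by_contra hc
    exact hσ (h σ (Finsupp.mem_support_iff.mpr hc))

/-- Realized prism chains lie in a supported subgroup as soon as all prism pieces do. [folklore] -/
lemma realizeCyl_mem_supported {n k : ℕ} (P : Set (SingularSimplex (Fin N → ℝ) k))
    {h : C(StdSimplex n × StdSimplex 1, Fin N → ℝ)}
    (hh : ∀ w : Fin (k + 1) → Fin (n + 1) × Fin 2, cylCompose h w ∈ P)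
    (c : TupleChain (Fin (n + 1) × Fin 2) k) : realizeCyl h k c ∈ Finsupp.supported ℤ ℤ P := by
  induction c using Finsupp.induction_linear with
  | zero => simp
  | add x y hx hy => rw [map_add]; exact Submodule.add_mem _ hx hy
  | single w z => rw [realizeCyl_single]; exact Finsupp.single_mem_supported ℤ z (hh w)

/-- **Chain-level closure from simplexwise closure.** If a family `P_d` of sets of singular simplices
of `ℝ^N` contains the rational affine simplices, is stable under restriction along rational affine
simplices of `Δ^d`, and is stable under the prism pieces of straight-line homotopies towards rational
affine simplices, then the chains supported on `P` satisfy the four hypotheses of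
`computesHomologyIn_of_closure`. [folklore] -/
theorem closure_of_simplexwise (P : (d : ℕ) → Set (SingularSimplex (Fin N → ℝ) d))
    (h1 : ∀ (d : ℕ) (Q : Fin (d + 1) → Fin N → ℚ), affSimplex (fun j i => ((Q j i : ℚ) : ℝ)) ∈ P d)
    (h2 : ∀ (d m : ℕ) (σ : SingularSimplex (Fin N → ℝ) d), σ ∈ P d →
      ∀ w : Fin (m + 1) → StdSimplex d, (∀ j, IsRatPt (w j)) → σ.compose w ∈ P m)
    (h3 : ∀ (d m : ℕ) (τ : SingularSimplex (Fin N → ℝ) d), τ ∈ P d →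
      ∀ (Q : Fin (d + 1) → Fin N → ℚ) (w : Fin (m + 1) → Fin (d + 1) × Fin 2),
        cylCompose (lineHtpy τ (affSimplex fun j i => ((Q j i : ℚ) : ℝ))) w ∈ P m) :
    (∀ (d : ℕ) (rq : (Fin N → ℝ) → Fin N → ℚ) (c : CChain ℤ (Fin N → ℝ) d),
        strOp (fun y i => ((rq y i : ℚ) : ℝ)) d c ∈ Finsupp.supported ℤ ℤ (P d)) ∧
    (∀ (d j : ℕ) (a : CChain ℤ (Fin N → ℝ) d), a ∈ Finsupp.supported ℤ ℤ (P d) →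
        ((sdX ℤ ℤ d) ^ j) a ∈ Finsupp.supported ℤ ℤ (P d)) ∧
    (∀ (d j : ℕ) (a : CChain ℤ (Fin N → ℝ) d), a ∈ Finsupp.supported ℤ ℤ (P d) →
        sdhSum ℤ ℤ j d a ∈ Finsupp.supported ℤ ℤ (P (d + 1))) ∧
    (∀ (d : ℕ) (rq : (Fin N → ℝ) → Fin N → ℚ) (a : CChain ℤ (Fin N → ℝ) d),
        a ∈ Finsupp.supported ℤ ℤ (P d) →
          prismOp (fun y i => ((rq y i : ℚ) : ℝ)) d a ∈ Finsupp.supported ℤ ℤ (P (d + 1))) := by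
  refine ⟨fun d rq c => ?_, fun d j a ha => ?_, fun d j a ha => ?_, fun d rq a ha => ?_⟩
  · -- straightening: every straightened simplex is a rational affine simplex
    rw [← Finsupp.sum_single c, Finsupp.sum, map_sum]
    refine Submodule.sum_mem _ fun τ _ => ?_
    rw [strOp_single]
    exact Finsupp.single_mem_supported ℤ _ (h1 d fun j => rq (vtx τ j))
  · -- iterated subdivision: restrictions along rational affine simplices
    rw [← Finsupp.sum_single a, Finsupp.sum, map_sum]
    refine Submodule.sum_mem _ fun σ hσ => ?_
    have hσP : σ ∈ P d := (mem_supported_iff_support (P d) a).mp ha σ hσ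
    rw [← realize_vertexTuple (R := ℤ) σ (a σ), sdX_pow_realize]
    refine realize_mem_of_forall _ fun w hw => Finsupp.single_mem_supported ℤ _ ?_
    exact h2 d d σ hσP w (isRatPt_of_mem_support_sd_iterate hw)
  · -- the chain homotopies `Dⱼ = ∑ T Sⁱ`
    rw [← Finsupp.sum_single a, Finsupp.sum, map_sum]
    refine Submodule.sum_mem _ fun σ hσ => ?_
    have hσP : σ ∈ P d := (mem_supported_iff_support (P d) a).mp ha σ hσ
    simp only [sdhSum, LinearMap.sum_apply, LinearMap.comp_apply]
    refine Submodule.sum_mem _ fun i _ => ?_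
    rw [← realize_vertexTuple (R := ℤ) σ (a σ), sdX_pow_realize, sdhX_realize]
    refine realize_mem_of_forall _ fun w hw => Finsupp.single_mem_supported ℤ _ ?_
    exact h2 d (d + 1) σ hσP w (isRatPt_of_mem_support_sdh_sd_iterate hw)
  · -- prisms
    rw [← Finsupp.sum_single a, Finsupp.sum, map_sum]
    refine Submodule.sum_mem _ fun τ hτ => ?_
    have hτP : τ ∈ P d := (mem_supported_iff_support (P d) a).mp ha τ hτ
    rw [prismOp_single]
    exact Submodule.smul_mem _ _ (realizeCyl_mem_supported (P (d + 1))
      (fun w => h3 d (d + 1) τ hτP (fun j => rq (vtx τ j)) w) _)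

end Simplexwise

/-! ### Evaluation formulas for restricted and prism simplices -/

section Formulas

open SingularSimplex StdSimplex

variable {N n m : ℕ}

/-- Coordinates of `stdSimplex.map f u`: the `c`-th one is the sum of the `uⱼ` over the fibre of `c`. [folklore] -/
lemma stdSimplex_map_apply {ι : Type*} [Fintype ι] [DecidableEq ι] (f : Fin (m + 1) → ι) (u : StdSimplex m) (c : ι) :
    stdSimplex.map f u c = ∑ j ∈ Finset.univ.filter (fun j => f j = c), u j := by
  simp only [stdSimplex.map_coe]
  rw [FunOnFinite.linearMap_apply_apply]

/-- `stdSimplex.map f u = ∑ⱼ uⱼ e_{f j}` as a vector. [folklore] -/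
lemma coe_stdSimplex_map (f : Fin (m + 1) → Fin (n + 1)) (u : StdSimplex m) :
    ((stdSimplex.map f u : StdSimplex n) : Fin (n + 1) → ℝ) =
      ∑ j, u j • (stdSimplex.vertex (S := ℝ) (f j) : Fin (n + 1) → ℝ) := by
  rw [stdSimplex_map_eq_affComb, coe_affComb]

/-- The value of a prism piece of a straight-line homotopy. [folklore] -/
lemma toContinuousMap_cylCompose_lineHtpy (τ τ' : SingularSimplex (Fin N → ℝ) n)
    (w : Fin (m + 1) → Fin (n + 1) × Fin 2) (u : StdSimplex m) :
    toContinuousMap (cylCompose (lineHtpy τ τ') w) u =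
      (stdSimplex.map (fun j => (w j).2) u 0) • toContinuousMap τ (stdSimplex.map (fun j => (w j).1) u) +
        (stdSimplex.map (fun j => (w j).2) u 1) • toContinuousMap τ' (stdSimplex.map (fun j => (w j).1) u) := by
  rw [cylCompose, toContinuousMap_ofMap]
  rfl

/-- The value of an affine simplex on `stdSimplex.map f u`. [folklore] -/
lemma toContinuousMap_affSimplex_map (p : Fin (n + 1) → Fin N → ℝ) (f : Fin (m + 1) → Fin (n + 1))
    (u : StdSimplex m) : toContinuousMap (affSimplex p) (stdSimplex.map f u) = ∑ j, u j • p (f j) := by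
  rw [affSimplex_apply, sum_stdSimplex_map_smul]

end Formulas

/-! ### Semialgebraic closure properties -/

section Semialg

open SingularSimplex StdSimplex MvPolynomial Literature.NumberTheory.Transcendental

variable {k : Type*} [Field k] [Algebra k ℝ] {N n m : ℕ}

/-- The linear form `∑ⱼ qⱼ Xⱼ` with rational coefficients, as a polynomial over `k`. [folklore] -/
def linPoly (k : Type*) [Field k] (q : Fin (m + 1) → ℚ) : MvPolynomial (Fin (m + 1)) k :=
  ∑ j, C ((q j : ℚ) : k) * X j

omit [Algebra k ℝ] in
/-- Unfolding `linPoly`. [folklore] -/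
lemma linPoly_def (q : Fin (m + 1) → ℚ) : linPoly k q = ∑ j, C ((q j : ℚ) : k) * X j := rfl

/-- `linPoly q` evaluates to `∑ⱼ uⱼ qⱼ`. [folklore] -/
lemma aeval_linPoly (q : Fin (m + 1) → ℚ) (u : Fin (m + 1) → ℝ) :
    aeval u (linPoly k q) = ∑ j, u j * (q j : ℝ) := by
  simp only [linPoly, map_sum, map_mul, aeval_C, map_ratCast, aeval_X]
  exact Finset.sum_congr rfl fun j _ => mul_comm _ _

/-- **Rational affine simplices are `k`-semialgebraic** (their graph is cut out by linear equations
with rational coefficients over the semialgebraic standard simplex). [folklore] -/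
theorem isSemialg_affSimplex_rat (Q : Fin (n + 1) → Fin N → ℚ) :
    SingularSimplex.IsSemialg k (affSimplex (n := n) fun j i => ((Q j i : ℚ) : ℝ)) := by
  unfold SingularSimplex.IsSemialg
  refine (isSemialgebraicMapOn_aeval (isSemialgebraic_stdSimplex k (n + 1))
    (fun i => linPoly k fun j => Q j i)).congr fun t ht => ?_
  funext i
  beta_reduce
  rw [aeval_linPoly, SingularSimplex.extend_apply_of_mem _ ht, affSimplex_apply, Finset.sum_apply]
  simp only [Pi.smul_apply, smul_eq_mul]
  rfl

/-- **Restrictions of `k`-semialgebraic simplices along rational affine simplices of `Δⁿ` are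
`k`-semialgebraic** (composition of semialgebraic maps, BCR Prop. 2.2.6, with a polynomial map with
rational coefficients). [folklore] -/
theorem isSemialg_compose {σ : SingularSimplex (Fin N → ℝ) n} (hσ : SingularSimplex.IsSemialg k σ)
    (w : Fin (m + 1) → StdSimplex n) (hw : ∀ j, IsRatPt (w j)) :
    SingularSimplex.IsSemialg k (σ.compose w) := by
  choose Q hQ using fun j i => hw j i
  set L : (Fin (m + 1) → ℝ) → (Fin (n + 1) → ℝ) := fun u i => aeval u (linPoly k fun j => Q j i) with hL
  have hLs : IsSemialgebraicMapOn k (stdSimplex ℝ (Fin (m + 1))) L :=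
    isSemialgebraicMapOn_aeval (isSemialgebraic_stdSimplex k (m + 1)) _
  have hLeq : ∀ (u : Fin (m + 1) → ℝ) (hu : u ∈ stdSimplex ℝ (Fin (m + 1))),
      L u = ((affComb w ⟨u, hu⟩ : StdSimplex n) : Fin (n + 1) → ℝ) := by
    intro u hu
    funext i
    change aeval u (linPoly k fun j => Q j i) = affComb w ⟨u, hu⟩ i
    rw [aeval_linPoly, affComb_apply]
    exact Finset.sum_congr rfl fun j _ => by rw [hQ j i]; rfl
  have hmaps : MapsTo L (stdSimplex ℝ (Fin (m + 1))) (stdSimplex ℝ (Fin (n + 1))) := fun u hu => by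
    rw [hLeq u hu]
    exact (affComb w ⟨u, hu⟩).2
  unfold SingularSimplex.IsSemialg at hσ ⊢
  refine (IsSemialgebraicMapOn.comp_holds hσ hLs hmaps).congr fun u hu => ?_
  rw [Function.comp_apply, SingularSimplex.extend_apply_of_mem _ hu, toContinuousMap_compose,
    ContinuousMap.comp_apply, affMap_apply, SingularSimplex.extend_apply_of_mem _ (hmaps hu)]
  congr 1
  exact Subtype.ext (hLeq u hu)

/-- **Prism pieces of the straight-line homotopy from a `k`-semialgebraic simplex to a rational
affine simplex are `k`-semialgebraic**: coordinatewise they are `b₀(u) · τ(L u) + b₁(u) · ℓ(L u)`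
with `b₀, b₁, L, ℓ` polynomial with rational coefficients (BCR Prop. 2.2.6: sums, products and
composites of semialgebraic functions). [folklore] -/
theorem isSemialg_cylCompose_lineHtpy {τ : SingularSimplex (Fin N → ℝ) n}
    (hτ : SingularSimplex.IsSemialg k τ) (Q : Fin (n + 1) → Fin N → ℚ)
    (w : Fin (m + 1) → Fin (n + 1) × Fin 2) :
    SingularSimplex.IsSemialg k
      (cylCompose (lineHtpy τ (affSimplex fun j i => ((Q j i : ℚ) : ℝ))) w) := by
  have hs := isSemialgebraic_stdSimplex k (m + 1)
  -- the polynomial data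
  set Bp : Fin 2 → MvPolynomial (Fin (m + 1)) k :=
    fun c => ∑ j ∈ Finset.univ.filter (fun j => (w j).2 = c), X j with hBp
  set Lp : Fin (n + 1) → MvPolynomial (Fin (m + 1)) k :=
    fun i' => ∑ j ∈ Finset.univ.filter (fun j => (w j).1 = i'), X j with hLp
  set L : (Fin (m + 1) → ℝ) → (Fin (n + 1) → ℝ) := fun u i' => aeval u (Lp i') with hL
  have hLs : IsSemialgebraicMapOn k (stdSimplex ℝ (Fin (m + 1))) L := isSemialgebraicMapOn_aeval hs Lp
  have hBeval : ∀ (u : Fin (m + 1) → ℝ) (c : Fin 2),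
      aeval u (Bp c) = ∑ j ∈ Finset.univ.filter (fun j => (w j).2 = c), u j := by
    intro u c
    simp only [hBp, map_sum, aeval_X]
  have hLeval : ∀ (u : Fin (m + 1) → ℝ) (hu : u ∈ stdSimplex ℝ (Fin (m + 1))),
      L u = ((stdSimplex.map (fun j => (w j).1) ⟨u, hu⟩ : StdSimplex n) : Fin (n + 1) → ℝ) := by
    intro u hu
    funext i'
    change aeval u (Lp i') = stdSimplex.map (fun j => (w j).1) ⟨u, hu⟩ i'
    rw [stdSimplex_map_apply]
    simp only [hLp, map_sum, aeval_X]
    rfl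
  have hBval : ∀ (u : Fin (m + 1) → ℝ) (hu : u ∈ stdSimplex ℝ (Fin (m + 1))) (c : Fin 2),
      stdSimplex.map (fun j => (w j).2) ⟨u, hu⟩ c = aeval u (Bp c) := by
    intro u hu c
    rw [stdSimplex_map_apply, hBeval]
    rfl
  have hmaps : MapsTo L (stdSimplex ℝ (Fin (m + 1))) (stdSimplex ℝ (Fin (n + 1))) := fun u hu => by
    rw [hLeval u hu]
    exact (stdSimplex.map (fun j => (w j).1) ⟨u, hu⟩).2
  have hτc : ∀ c', IsSemialgebraicFunOn k (stdSimplex ℝ (Fin (n + 1)))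
      (fun y => SingularSimplex.extend τ y c') :=
    (isSemialgebraicMapOn_iff_forall_holds (isSemialgebraic_stdSimplex k (n + 1))).mp hτ
  unfold SingularSimplex.IsSemialg
  refine IsSemialgebraicMapOn.of_forall hs fun c' => ?_
  have hF : IsSemialgebraicFunOn k (stdSimplex ℝ (Fin (m + 1)))
      ((fun u => aeval u (Bp 0)) * ((fun y => SingularSimplex.extend τ y c') ∘ L) +
        fun u => aeval u (Bp 1 * linPoly k fun j => Q (w j).1 c')) :=
    IsSemialgebraicFunOn.add_holds
      (IsSemialgebraicFunOn.mul_holds (isSemialgebraicFunOn_aeval hs _)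
        (IsSemialgebraicFunOn.comp_isSemialgebraicMapOn_holds (hτc c') hLs hmaps))
      (isSemialgebraicFunOn_aeval hs _)
  refine hF.congr fun u hu => ?_
  simp only [Pi.add_apply, Pi.mul_apply, Function.comp_apply, map_mul, aeval_linPoly]
  rw [SingularSimplex.extend_apply_of_mem _ hu, toContinuousMap_cylCompose_lineHtpy,
    toContinuousMap_affSimplex_map, ← SingularSimplex.extend_apply τ, ← hLeval u hu, hBval u hu 0,
    hBval u hu 1, Pi.add_apply, Pi.smul_apply, Pi.smul_apply, smul_eq_mul, smul_eq_mul, Finset.sum_apply]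
  simp only [Pi.smul_apply, smul_eq_mul]
  rfl

end Semialg

/-! ### `C¹` on open faces: closure properties -/

section SmoothFaces

open SingularSimplex StdSimplex

variable {N n m : ℕ}

/-- The linear map `u ↦ ∑ⱼ uⱼ pⱼ` as a continuous linear map. [folklore] -/
def linCLM {F : Type*} [NormedAddCommGroup F] [NormedSpace ℝ F] (p : Fin (m + 1) → F) :
    (Fin (m + 1) → ℝ) →L[ℝ] F :=
  ∑ j, (ContinuousLinearMap.proj j : (Fin (m + 1) → ℝ) →L[ℝ] ℝ).smulRight (p j)

/-- `linCLM p u = ∑ⱼ uⱼ pⱼ`. [folklore] -/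
@[simp] lemma linCLM_apply {F : Type*} [NormedAddCommGroup F] [NormedSpace ℝ F] (p : Fin (m + 1) → F)
    (u : Fin (m + 1) → ℝ) : linCLM p u = ∑ j, u j • p j := by
  simp [linCLM]

/-- The coordinate sum `u ↦ ∑_{j ∈ s} uⱼ` as a continuous linear map. [folklore] -/
def sumCLM (s : Finset (Fin (m + 1))) : (Fin (m + 1) → ℝ) →L[ℝ] ℝ :=
  ∑ j ∈ s, (ContinuousLinearMap.proj j : (Fin (m + 1) → ℝ) →L[ℝ] ℝ)

/-- `sumCLM s u = ∑_{j ∈ s} uⱼ`. [folklore] -/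
@[simp] lemma sumCLM_apply (s : Finset (Fin (m + 1))) (u : Fin (m + 1) → ℝ) : sumCLM s u = ∑ j ∈ s, u j := by
  simp [sumCLM]

/-- **Support tracking.** The affine map `u ↦ ∑ⱼ uⱼ wⱼ` of a tuple `w` of points of `Δⁿ` sends the
open face of `Δᵐ` with support `J` into the open face of `Δⁿ` whose support is the union of the
supports of the `wⱼ`, `j ∈ J` (all weights being nonnegative). [folklore] -/
lemma mapsTo_openFace (w : Fin (m + 1) → StdSimplex n) (J : Finset (Fin (m + 1))) :
    MapsTo (fun u : Fin (m + 1) → ℝ => ∑ j, u j • (w j : Fin (n + 1) → ℝ)) (openFace m J)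
      (openFace n (J.biUnion fun j => Finset.univ.filter fun i => 0 < w j i)) := by
  rintro u ⟨hu, hJ⟩
  have hmem : (∑ j, u j • (w j : Fin (n + 1) → ℝ)) ∈ stdSimplex ℝ (Fin (n + 1)) :=
    (convex_stdSimplex ℝ (Fin (n + 1))).sum_mem (fun j _ => hu.1 j) hu.2 fun j _ => (w j).2
  refine ⟨hmem, fun i => ?_⟩
  beta_reduce
  rw [Finset.sum_apply]
  simp only [Pi.smul_apply, smul_eq_mul, Finset.mem_biUnion, Finset.mem_filter, Finset.mem_univ,
    true_and]
  rw [Finset.sum_pos_iff_of_nonneg (fun j _ => mul_nonneg (hu.1 j) (stdSimplex.zero_le (w j) i))]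
  constructor
  · rintro ⟨j, -, hj⟩
    rcases pos_and_pos_or_neg_and_neg_of_mul_pos hj with ⟨ha, hb⟩ | ⟨ha, -⟩
    · exact ⟨j, (hJ j).mp ha, hb⟩
    · exact absurd ha (not_lt.mpr (hu.1 j))
  · rintro ⟨j, hj, hi⟩
    exact ⟨j, Finset.mem_univ _, mul_pos ((hJ j).mpr hj) hi⟩

/-- Affine simplices are `C¹` (indeed linear) on all open faces. [folklore] -/
theorem contDiffOnOpenFaces_affSimplex (p : Fin (n + 1) → Fin N → ℝ) :
    SingularSimplex.ContDiffOnOpenFaces (affSimplex p) := by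
  intro J
  refine ((linCLM p).contDiff.contDiffOn).congr fun u hu => ?_
  rw [SingularSimplex.extend_apply_of_mem _ (openFace_subset_stdSimplex _ _ hu), affSimplex_apply,
    linCLM_apply]
  rfl

/-- **Restrictions of simplices `C¹` on open faces along affine simplices of `Δⁿ` are `C¹` on open
faces** (chain rule; open faces go to open faces by `mapsTo_openFace`). [folklore] -/
theorem contDiffOnOpenFaces_compose {σ : SingularSimplex (Fin N → ℝ) n}
    (hσ : SingularSimplex.ContDiffOnOpenFaces σ) (w : Fin (m + 1) → StdSimplex n) :
    SingularSimplex.ContDiffOnOpenFaces (σ.compose w) := by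
  intro J
  have hmaps : MapsTo (linCLM fun j => (w j : Fin (n + 1) → ℝ)) (openFace m J)
      (openFace n (J.biUnion fun j => Finset.univ.filter fun i => 0 < w j i)) := fun u hu => by
    rw [linCLM_apply]
    exact mapsTo_openFace w J hu
  refine ((hσ _).comp (linCLM fun j => (w j : Fin (n + 1) → ℝ)).contDiff.contDiffOn hmaps).congr
    fun u hu => ?_
  have hu' := openFace_subset_stdSimplex _ _ hu
  rw [Function.comp_apply, SingularSimplex.extend_apply_of_mem _ hu', toContinuousMap_compose,
    ContinuousMap.comp_apply, affMap_apply, ← SingularSimplex.extend_apply σ, coe_affComb, linCLM_apply]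
  rfl

/-- **Prism pieces of the straight-line homotopy from a simplex `C¹` on open faces to an affine
simplex are `C¹` on open faces**: they are `u ↦ b₀(u) τ(L u) + b₁(u) ℓ(L u)` with `b₀, b₁, L, ℓ`
linear and `L` mapping open faces into open faces. [folklore] -/
theorem contDiffOnOpenFaces_cylCompose_lineHtpy {τ : SingularSimplex (Fin N → ℝ) n}
    (hτ : SingularSimplex.ContDiffOnOpenFaces τ) (p : Fin (n + 1) → Fin N → ℝ)
    (w : Fin (m + 1) → Fin (n + 1) × Fin 2) :
    SingularSimplex.ContDiffOnOpenFaces (cylCompose (lineHtpy τ (affSimplex p)) w) := by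
  intro J
  set wv : Fin (m + 1) → StdSimplex n := fun j => stdSimplex.vertex (w j).1 with hwv
  have hmaps : MapsTo (linCLM fun j => (wv j : Fin (n + 1) → ℝ)) (openFace m J)
      (openFace n (J.biUnion fun j => Finset.univ.filter fun i => 0 < wv j i)) := fun u hu => by
    rw [linCLM_apply]
    exact mapsTo_openFace wv J hu
  have hF : ContDiffOn ℝ 1
      (fun u => (sumCLM (Finset.univ.filter fun j => (w j).2 = 0) u) •
          (SingularSimplex.extend τ ∘ linCLM fun j => (wv j : Fin (n + 1) → ℝ)) u +
        (sumCLM (Finset.univ.filter fun j => (w j).2 = 1) u) • linCLM (fun j => p (w j).1) u)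
      (openFace m J) :=
    ((sumCLM _).contDiff.contDiffOn.smul
      ((hτ _).comp (linCLM fun j => (wv j : Fin (n + 1) → ℝ)).contDiff.contDiffOn hmaps)).add
      ((sumCLM _).contDiff.contDiffOn.smul (linCLM fun j => p (w j).1).contDiff.contDiffOn)
  refine hF.congr fun u hu => ?_
  have hu' := openFace_subset_stdSimplex _ _ hu
  rw [SingularSimplex.extend_apply_of_mem _ hu', toContinuousMap_cylCompose_lineHtpy,
    toContinuousMap_affSimplex_map, ← SingularSimplex.extend_apply τ,
    coe_stdSimplex_map (fun j => (w j).1) ⟨u, hu'⟩, stdSimplex_map_apply (fun j => (w j).2) ⟨u, hu'⟩ 0,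
    stdSimplex_map_apply (fun j => (w j).2) ⟨u, hu'⟩ 1, Function.comp_apply, linCLM_apply,
    linCLM_apply, sumCLM_apply, sumCLM_apply]
  rfl

end SmoothFaces

/-! ### The two subcomplexes and the discharge -/

section Main

open SingularSimplex

/-- Simplexwise closure properties of the `k`-semialgebraic simplices. [folklore] -/
theorem semialgSimplices_closure (k : Type) [Field k] [Algebra k ℝ] (N : ℕ) :
    (∀ (d : ℕ) (Q : Fin (d + 1) → Fin N → ℚ),
        affSimplex (fun j i => ((Q j i : ℚ) : ℝ)) ∈ semialgSimplices k N d) ∧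
    (∀ (d m : ℕ) (σ : SingularSimplex (Fin N → ℝ) d), σ ∈ semialgSimplices k N d →
        ∀ w : Fin (m + 1) → StdSimplex d, (∀ j, IsRatPt (w j)) → σ.compose w ∈ semialgSimplices k N m) ∧
    (∀ (d m : ℕ) (τ : SingularSimplex (Fin N → ℝ) d), τ ∈ semialgSimplices k N d →
        ∀ (Q : Fin (d + 1) → Fin N → ℚ) (w : Fin (m + 1) → Fin (d + 1) × Fin 2),
          cylCompose (lineHtpy τ (affSimplex fun j i => ((Q j i : ℚ) : ℝ))) w ∈ semialgSimplices k N m) :=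
  ⟨fun _ Q => isSemialg_affSimplex_rat Q, fun _ _ _ hσ w hw => isSemialg_compose hσ w hw,
    fun _ _ _ hτ Q w => isSemialg_cylCompose_lineHtpy hτ Q w⟩

/-- Simplexwise closure properties of the `k`-semialgebraic simplices `C¹` on open faces. [folklore] -/
theorem semialgC1Simplices_closure (k : Type) [Field k] [Algebra k ℝ] (N : ℕ) :
    (∀ (d : ℕ) (Q : Fin (d + 1) → Fin N → ℚ),
        affSimplex (fun j i => ((Q j i : ℚ) : ℝ)) ∈ semialgC1Simplices k N d) ∧
    (∀ (d m : ℕ) (σ : SingularSimplex (Fin N → ℝ) d), σ ∈ semialgC1Simplices k N d →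
        ∀ w : Fin (m + 1) → StdSimplex d, (∀ j, IsRatPt (w j)) → σ.compose w ∈ semialgC1Simplices k N m) ∧
    (∀ (d m : ℕ) (τ : SingularSimplex (Fin N → ℝ) d), τ ∈ semialgC1Simplices k N d →
        ∀ (Q : Fin (d + 1) → Fin N → ℚ) (w : Fin (m + 1) → Fin (d + 1) × Fin 2),
          cylCompose (lineHtpy τ (affSimplex fun j i => ((Q j i : ℚ) : ℝ))) w ∈
            semialgC1Simplices k N m) :=
  ⟨fun _ Q => ⟨isSemialg_affSimplex_rat Q, contDiffOnOpenFaces_affSimplex _⟩,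
    fun _ _ _ hσ w hw => ⟨isSemialg_compose hσ.1 w hw, contDiffOnOpenFaces_compose hσ.2 w⟩,
    fun _ _ _ hτ Q w => ⟨isSemialg_cylCompose_lineHtpy hτ.1 Q w,
      contDiffOnOpenFaces_cylCompose_lineHtpy hτ.2 _ w⟩⟩

end Main

end Huber2023

/-- **Discharge of `Huber2023_semialgChains_quasiIso`** (Huber 2023/24, Proposition 7.4, for the
instance `X = U` an open `k`-semialgebraic subset of `ℝ^N`): the `k`-semialgebraic singular chains
in `U`, and those `C¹` on open faces, compute `H_•(U; ℤ)`. Proof: the elementary form of the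
printed fine-resolution argument — iterated barycentric subdivision makes chains small
(Hatcher Prop. 2.21), small simplices are straightened to rational affine simplices inside balls of
`U` through the explicit affine prism operator of the straight-line homotopy (Hatcher Thm. 2.10,
Warner 5.32), and the subcomplexes are stable under all these operations (rationality of the
vertices of `Sʲ Δⁿ`; sums, products and composites of semialgebraic maps, BCR Prop. 2.2.6, via the
tree's Tarski–Seidenberg theorem; chain rule on open faces).
[cite: Huber2023, Proposition 7.4 with Notation 7.1, Remark 7.2 and §5] -/
theorem Huber2023_semialgChains_quasiIso_holds : Huber2023_semialgChains_quasiIso := by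
  intro k _ _ N U hU _
  obtain ⟨h1, h2, h3⟩ := Huber2023.semialgSimplices_closure k N
  obtain ⟨g1, g2, g3⟩ := Huber2023.semialgC1Simplices_closure k N
  obtain ⟨a1, a2, a2', a3⟩ := Huber2023.closure_of_simplexwise (semialgSimplices k N) h1 h2 h3
  obtain ⟨b1, b2, b2', b3⟩ := Huber2023.closure_of_simplexwise (semialgC1Simplices k N) g1 g2 g3
  exact ⟨Huber2023.computesHomologyIn_of_closure U hU (fun d => semialgChains k N d) a1 a2 a2' a3,
    Huber2023.computesHomologyIn_of_closure U hU (fun d => semialgC1Chains k N d) b1 b2 b2' b3⟩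

end Literature.ModelTheory.ExponentialFields
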